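/-
Copyright: width seat `ym-line-sll-p2` (prover-ym-line-sll-p2-g2-0), route `SoftLoopLongLag`, crux T′ `ColdBoxSoftLoopLagFloor`
(stmt-QuantumFields-24180), line `birth`, registered stub E1a `stub_innerFlatLagFloorG`, brick 3.
-/
import Summits.QuantumFields.YangMills.Theorems.SoftLoopLongLagDefs
import Literature.MathematicalPhysics.QuantumLattice.CentreSymmetryConfinementProofs
import Literature.MathematicalPhysics.QuantumFieldTheory.LatticeMaxwellGaussian

/-!
# Route `SoftLoopLongLag`, crux T′, stub E1a, brick E1a-3 «LoopStokes»: the ABELIAN circulation of an edge function around a lattice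
# walk, its value on straight walks and rectangles, and LATTICE STOKES for the `R×T` rectangle (G-free, β-free)

The one-scale expansion of the soft-loop observable (bricks E1a-4/5) replaces the Wilson loop `N⁻¹ Re tr ρ(hol)` of the `R×R` square by
`1 − ‖Σ_k σ_k a_k‖²/(2N)` (the tree's `abs_cost_expChart_listProd_sub_half_norm_sq_le`), where `Σ_k σ_k a_k` is the SIGNED sum of the
chart coordinates along the darts of the walk — colour by colour, the **circulation** of a real edge function `f` around the walk,
`circ_w(f) = Σ_{darts d of w} ± f(edge of d)` (written out through the tree's `dartStep`, no new definition).  This file computes it: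

* `toAdd_walkHolonomy_ofAdd` — `circ_w(f)` is the walk holonomy of the `Multiplicative ℝ`-valued configuration `ofAdd ∘ f` (so the tree's
  holonomy algebra — `walkHolonomy_append/reverse`, `walkHolonomy_rectWalk`, `lineHol` — applies verbatim to circulations);
* `toAdd_lineHol_ofAdd` — along the straight walk: `Σ_{k<n} f(y + k eᵢ, i)`;
* `circ_rectWalk` — around the rectangle: `S_i(R,x) + S_j(T,x+Reᵢ) − S_i(R,x+Teⱼ) − S_j(T,x)`;
* `sum_sCirc_rect_eq` — **lattice Stokes**: the same four sums equal `Σ_{a<R,b<T} sCirc f (x + a eᵢ + b eⱼ; i, j)` (two telescoping sums;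
  `LatticeMaxwell.sCirc` is the plaquette circulation `f(y,i) + f(y+eᵢ,j) − f(y+eⱼ,i) − f(y,j)`);
* `circ_rectWalk_eq_sum_rectSurface` — for the route's `(1,2)`-square: `circ_{rectWalk x 1 2 R T}(f) = Σ_{p ∈ rectSurface x R T} sCirc f p`.

No sorry; no new definition; standard axioms.  HONEST LABEL: rung R2xi-G RECORD label (leaf `WeakCouplingRates.XiPow`, an UPPER bound on the
lattice mass gap); NOT the Clay mass gap; no summit statement is touched.

References: K. Wilson, Phys. Rev. D 10 (1974) §III (lattice Stokes for abelian link variables); E. Seiler, LNP 159 (1982) Ch. 1.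
-/

set_option autoImplicit false

noncomputable section

open Finset
open Literature.Probability.LatticeModels (Site zdGraph)
open Literature.MathematicalPhysics.QuantumLattice
open Literature.MathematicalPhysics.QuantumFieldTheory.LatticeMaxwell (sCirc)

namespace Summit.QuantumFields.YangMills.Theorems.SoftLoopLongLag

variable {d : ℕ}

/-! ## Circulations as `Multiplicative ℝ` holonomies -/

/-- A list product of `ofAdd`'s is `ofAdd` of the list sum. -/
theorem toAdd_list_prod_map_ofAdd {α : Type*} (l : List α) (g : α → ℝ) :
    Multiplicative.toAdd (l.map fun x => Multiplicative.ofAdd (g x)).prod = (l.map g).sum := by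
  induction l with
  | nil => simp
  | cons x l ih => simp [ih]

/-- The dart holonomy of the configuration `ofAdd ∘ f` is `ofAdd` of the signed edge value. -/
theorem dartHolonomy_ofAdd (f : ZdEdge d → ℝ) (e : (zdGraph d).Dart) :
    dartHolonomy (G := Multiplicative ℝ) (fun e' => Multiplicative.ofAdd (f e')) e =
      Multiplicative.ofAdd (if (dartStep e).2 then f (dartStep e).1 else -f (dartStep e).1) := by
  unfold dartHolonomy
  cases (dartStep e).2 <;> simp [ofAdd_neg]

/-- **The circulation is an abelian holonomy**: `Σ_{darts} ±f = toAdd (hol_w(ofAdd ∘ f))`. -/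
theorem toAdd_walkHolonomy_ofAdd (f : ZdEdge d → ℝ) {x y : Site d} (w : (zdGraph d).Walk x y) :
    Multiplicative.toAdd (walkHolonomy (G := Multiplicative ℝ) (fun e' => Multiplicative.ofAdd (f e')) w) =
      (w.darts.map fun e => if (dartStep e).2 then f (dartStep e).1 else -f (dartStep e).1).sum := by
  rw [walkHolonomy, ← toAdd_list_prod_map_ofAdd]
  congr 2

/-- **Circulation along a straight walk**: `toAdd (lineHol (ofAdd ∘ f) i n y) = Σ_{k<n} f(y + k eᵢ, i)`. -/
theorem toAdd_lineHol_ofAdd (f : ZdEdge d → ℝ) (i : Fin d) :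
    ∀ (n : ℕ) (y : Site d), Multiplicative.toAdd (lineHol (G := Multiplicative ℝ) (fun e' => Multiplicative.ofAdd (f e')) i n y) =
      ∑ k ∈ range n, f (y + Pi.single i (k : ℤ), i)
  | 0, y => by simp
  | n + 1, y => by
    rw [lineHol_succ, toAdd_mul, toAdd_ofAdd, toAdd_lineHol_ofAdd f i n, Finset.sum_range_succ']
    simp only [Nat.cast_zero, Pi.single_zero, add_zero, Nat.cast_succ]
    rw [add_comm]
    congr 1
    refine Finset.sum_congr rfl fun k _ => ?_
    rw [add_assoc, ← Pi.single_add, add_comm (1 : ℤ)]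

/-- **Circulation around the rectangle** `rectWalk x i j R T`:
`Σ_{k<R} f(x+keᵢ,i) + Σ_{k<T} f(x+Reᵢ+keⱼ,j) − Σ_{k<R} f(x+Teⱼ+keᵢ,i) − Σ_{k<T} f(x+keⱼ,j)`. -/
theorem circ_rectWalk (f : ZdEdge d → ℝ) (x : Site d) (i j : Fin d) (R T : ℕ) :
    ((rectWalk x i j R T).darts.map fun e => if (dartStep e).2 then f (dartStep e).1 else -f (dartStep e).1).sum =
      (∑ k ∈ range R, f (x + Pi.single i (k : ℤ), i)) + (∑ k ∈ range T, f (x + Pi.single i (R : ℤ) + Pi.single j (k : ℤ), j)) -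
        (∑ k ∈ range R, f (x + Pi.single j (T : ℤ) + Pi.single i (k : ℤ), i)) - ∑ k ∈ range T, f (x + Pi.single j (k : ℤ), j) := by
  classical
  rw [← toAdd_walkHolonomy_ofAdd, walkHolonomy_rectWalk, toAdd_mul, toAdd_mul, toAdd_mul, toAdd_inv, toAdd_inv,
    toAdd_lineHol_ofAdd, toAdd_lineHol_ofAdd, toAdd_lineHol_ofAdd, toAdd_lineHol_ofAdd]
  ring

/-! ## Lattice Stokes for the rectangle -/

/-- **Lattice Stokes** for the `R×T` rectangle at `x` in the `(i,j)` plane: the sum of the plaquette circulations `sCirc f` over the spanning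
surface equals the boundary circulation (the four side sums of `circ_rectWalk`). -/
theorem sum_sCirc_rect_eq (f : ZdEdge d → ℝ) (x : Site d) (i j : Fin d) (R T : ℕ) :
    ∑ ab ∈ range R ×ˢ range T, sCirc f (x + Pi.single i (ab.1 : ℤ) + Pi.single j (ab.2 : ℤ), i, j) =
      (∑ k ∈ range R, f (x + Pi.single i (k : ℤ), i)) + (∑ k ∈ range T, f (x + Pi.single i (R : ℤ) + Pi.single j (k : ℤ), j)) -
        (∑ k ∈ range R, f (x + Pi.single j (T : ℤ) + Pi.single i (k : ℤ), i)) - ∑ k ∈ range T, f (x + Pi.single j (k : ℤ), j) := by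
  -- the two families of terms
  set F₁ : ℕ → ℕ → ℝ := fun a b => f (x + Pi.single i (a : ℤ) + Pi.single j (b : ℤ), i) with hF₁
  set F₂ : ℕ → ℕ → ℝ := fun a b => f (x + Pi.single i (a : ℤ) + Pi.single j (b : ℤ), j) with hF₂
  have hterm : ∀ a b : ℕ, sCirc f (x + Pi.single i (a : ℤ) + Pi.single j (b : ℤ), i, j) =
      (F₁ a b - F₁ a (b + 1)) + (F₂ (a + 1) b - F₂ a b) := by
    intro a b
    simp only [sCirc, hF₁, hF₂, Nat.cast_succ]
    have e1 : x + Pi.single i (a : ℤ) + Pi.single j (b : ℤ) + Pi.single i 1 = x + Pi.single i ((a : ℤ) + 1) + Pi.single j (b : ℤ) := by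
      rw [Pi.single_add]; abel
    have e2 : x + Pi.single i (a : ℤ) + Pi.single j (b : ℤ) + Pi.single j 1 = x + Pi.single i (a : ℤ) + Pi.single j ((b : ℤ) + 1) := by
      rw [Pi.single_add]; abel
    rw [e1, e2]
    ring
  rw [Finset.sum_product]
  simp_rw [hterm, Finset.sum_add_distrib]
  -- telescoping in `b` for the first family, in `a` for the second
  have h1 : ∀ a : ℕ, ∑ b ∈ range T, (F₁ a b - F₁ a (b + 1)) = F₁ a 0 - F₁ a T := fun a => by
    have := Finset.sum_range_sub (fun b => F₁ a b) T
    linarith [Finset.sum_neg_distrib (f := fun b => F₁ a (b + 1) - F₁ a b) (s := range T),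
      show ∑ b ∈ range T, (F₁ a b - F₁ a (b + 1)) = -∑ b ∈ range T, (F₁ a (b + 1) - F₁ a b) by
        rw [← Finset.sum_neg_distrib]; exact Finset.sum_congr rfl fun b _ => by ring]
  have h2 : ∑ a ∈ range R, ∑ b ∈ range T, (F₂ (a + 1) b - F₂ a b) = ∑ b ∈ range T, (F₂ R b - F₂ 0 b) := by
    rw [Finset.sum_comm]
    refine Finset.sum_congr rfl fun b _ => ?_
    exact Finset.sum_range_sub (fun a => F₂ a b) R
  simp_rw [h1]
  rw [h2, Finset.sum_sub_distrib, Finset.sum_sub_distrib]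
  simp only [hF₁, hF₂, Nat.cast_zero, Pi.single_zero, add_zero]
  have e3 : ∀ k : ℕ, x + Pi.single i (k : ℤ) + Pi.single j (T : ℤ) = x + Pi.single j (T : ℤ) + Pi.single i (k : ℤ) := fun k =>
    add_right_comm _ _ _
  simp_rw [e3]
  ring

/-- The parametrisation of the spanning surface of the `(1,2)`-rectangle is injective. -/
theorem rectSurface_param_injective (x : Site 4) :
    Function.Injective fun ab : ℕ × ℕ =>
      ((x + Pi.single 1 (ab.1 : ℤ) + Pi.single 2 (ab.2 : ℤ), ⟨((1 : Fin 4), (2 : Fin 4)), by decide⟩) : ZdPlaquette 4) := by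
  intro ab ab' h
  have h1 := congrArg (fun p : ZdPlaquette 4 => p.1 1) h
  have h2 := congrArg (fun p : ZdPlaquette 4 => p.1 2) h
  simp only [Pi.add_apply, Pi.single_apply] at h1 h2
  simp only [if_true, show ((1 : Fin 4) = 2) = False by decide, show ((2 : Fin 4) = 1) = False by decide, if_false,
    add_zero] at h1 h2
  have ha : (ab.1 : ℤ) = ab'.1 := by linarith
  have hb : (ab.2 : ℤ) = ab'.2 := by linarith
  exact Prod.ext (by exact_mod_cast ha) (by exact_mod_cast hb)

/-- **Lattice Stokes for the route's spanning surface**: the circulation of `f` around `rectWalk x 1 2 R T` is the sum of the plaquette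
circulations over `rectSurface x R T`. -/
theorem circ_rectWalk_eq_sum_rectSurface (f : ZdEdge 4 → ℝ) (x : Site 4) (R T : ℕ) :
    ((rectWalk x 1 2 R T).darts.map fun e => if (dartStep e).2 then f (dartStep e).1 else -f (dartStep e).1).sum =
      ∑ p ∈ rectSurface x R T, sCirc f (p.1, p.2.1.1, p.2.1.2) := by
  rw [circ_rectWalk, rectSurface, Finset.sum_image fun ab _ ab' _ h => rectSurface_param_injective x h]
  exact (sum_sCirc_rect_eq f x 1 2 R T).symm

/-! ## Sizes -/

/-- The number of darts of the rectangle is its perimeter `2(R+T)`. -/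
theorem length_darts_rectWalk (x : Site d) (i j : Fin d) (R T : ℕ) :
    (rectWalk x i j R T).darts.length = 2 * (R + T) := by
  rw [SimpleGraph.Walk.length_darts, length_rectWalk]

/-- A signed dart sum is bounded by (number of darts) × (a bound on `|f|` along the walk): if `|f e| ≤ m` for every edge then
`|circ_w(f)| ≤ #darts · m`; stated for the norms of vector-valued edge functions, as used by the chart expansion. -/
theorem sum_map_norm_signed_le {E : Type*} [SeminormedAddCommGroup E] (a : ZdEdge d → E) {m : ℝ}
    (ha : ∀ e, ‖a e‖ ≤ m) {x y : Site d} (w : (zdGraph d).Walk x y) :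
    ((w.darts.map fun e => if (dartStep e).2 then a (dartStep e).1 else -a (dartStep e).1).map (‖·‖)).sum ≤
      w.darts.length * m := by
  rw [List.map_map]
  have h : ∀ e ∈ w.darts, ((‖·‖) ∘ fun e => if (dartStep e).2 then a (dartStep e).1 else -a (dartStep e).1) e ≤ m := by
    intro e _
    simp only [Function.comp_apply]
    split_ifs
    · exact ha _
    · rw [norm_neg]; exact ha _
  have := List.sum_le_card_nsmul _ m (fun v hv => by
    obtain ⟨e, he, rfl⟩ := List.mem_map.1 hv
    exact h e he)
  simpa [List.length_map, nsmul_eq_mul] using this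

end Summit.QuantumFields.YangMills.Theorems.SoftLoopLongLag

end
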